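import Literature.MathematicalPhysics.QuantumFieldTheory.BalabanImbrieJaffe1984to88.BIJ85CovariantHiggsDictionary
import Literature.MathematicalPhysics.QuantumFieldTheory.Balaban1983to89.B1Ineq225RegularRegion
import Literature.MathematicalPhysics.QuantumFieldTheory.Balaban1983to89.HiggsRescaling

/-!
# `BalabanImbrieJaffe1984to88.BIJ85NeumannPropagatorRegularDecay` — T. Bałaban, J. Imbrie, A. Jaffe, *Renormalization of the Higgs model:
# minimizers, propagators and the stability of mean field theory*, Commun. Math. Phys. **97** (1985) 299–329 [BalabanImbrieJaffe1985], §7.3 p. 326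
# [PDF 28] «The propagators arising from Δ_k(u_k) … also satisfy the regularity and decay estimates of [7]», [7] = T. Bałaban, *Regularity and decay
# of lattice Green's functions*, Commun. Math. Phys. **89** (1983) 571–597 [Balaban1983RegularityDecay] Theorem p. 573 (1.10), [B1] = T. Bałaban,
# *(Higgs)₂,₃ quantum fields in a finite volume. I*, Commun. Math. Phys. **85** (1982) 603–626 [Balaban1982Higgs1] Prop. 2.1 (2.23)/(2.25) p. 610:
# **THE DECAY MEMBER (1.10)/(2.25), VALUE FORM, FOR THE REGION NEUMANN PROPAGATORS `G_k(Ω,u)` OF [BalabanImbrieJaffe1988] (2.27)/(5.6.10)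
# (p31's `gBox (α_kL^{kd}) ε⁻¹ u k Ω`) AT `u = e^{ieεA}` WITH `A` (2.23)-REGULAR ON A BIG-BLOCK REGION `Ω` — PROVED from p35's [B1] Prop. 2.1 for
# regions (`B1Ineq225RegularRegion.norm_propagatorK_region_reg_decay_sum`) BY NAME through the non-zero-field dictionary
# (`BIJ85CovariantHiggsDictionary`, this seat), an `ε`-scaling at fixed charge, the massive problems `m² = t² ∈ (0, 1]` and `t ↓ 0`.**

statement-level skeleton of published theorems with citation tags; proofs where landed; nothing here is a claim about the Yang–Mills mass gap

PDFs held: `paper:balaban1985-cmp97-bij-higgs-minimizers` (journal page = PDF page + 298; p. 326 [PDF 28]); `paper:balaban1982-cmp85-higgs23-i`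
(journal page = PDF page + 602; pp. 607, 610 [PDF 5, 8]); `paper:balaban1983-cmp89-regularity-decay` (journal page = PDF page + 570; p. 573 [PDF 3]).

CITATION HEADER (lean-in-tree rule).  Cell `lit-balaban` (HOME `run/shared/lean/pub/lit-balaban/`), Phase 2, reader seat **r01 gen 25** (unit
`lit-balaban-r01`, literature-prover-lit-balaban-r01-g25-0; B4 fold owner), free-target protocol G.5-34(d), TAKING line HOME/STATUS.md
2026-08-22T23:23:28Z (file 2 of the 22:31:42Z programme; file 1 = `BIJ85CovariantHiggsDictionary`, p343774).  Rows served (cells only, no head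
change): **B4.Thm@573** (owner r01: the C2-carrier instance of [7]'s Theorem p. 573 at `A ≠ 0`, value member (1.10), REGIONS), **C1.Eq7.3.1-7.3.2**
(owner r15: the decay half of the p. 326 sentence for the REGION propagators — p33's `BIJ85Claim73PropagatorDecay` is the whole-torus Kato/Agmon route
for `Δ_k(u_k)`), **C2.Eq2.27** (owner r18: p31 g19 / p27 g32 HONEST SCOPE «no Neumann sub-domains G_k(□,u) at non-flat fields» — here they are, at
`u = e^{ieεA}`).  USED BY NAME, never restated: p35's `B1Ineq225RegularRegion.norm_propagatorK_region_reg_decay_sum` (with its vocabulary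
`B1TorusCubeCover.half`, `B1TorusCubeLocality26.rS`, `B1TorusRegionHSizes.IsBigBlockUnion`, `B1TorusRegionRop.chi`), typer's `HiggsLattice` /
`HiggsAveraging` / `HiggsCovariance` and `HiggsRescaling.Params.scaleBy`/`mesh_scaleBy` ((1.22) p. 607 «T_ε by T_{sε}»), r14/p35's
`HiggsCovarianceCont.fwdTerm_apply`/`bwdTerm_apply`, `HiggsCovariancePos.covOpK_injective`/`propagatorK_covOpK_apply`/`covOpK_propagatorK_apply`,
p31's `BIJ88NeumannPropagator227Torus` (`nOp`, `nPad`, `gBox`, `proj`, `isUnit_nPad`, `nOp_mul_gBox`, `gBox_mul_proj`) and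
`BIJ88NeumannNoZeroModesTorus.IsBlockUnion`, p11's `BIJ85BlockAveragesTorusK.mem_blockK`, pv07's `Setup`/`TorusGeometry`/`B1RG242Torus.α`, r16's
`LatticeFieldCalculus.supDist`, and this seat's `BIJ85CovariantHiggsDictionary` (`rotCharge`, `higgsOf`, `eSite`, `expGauge`, `vecH`, `rfield`, `regH`,
`covOpK_rfield`, `propagatorK_rfield_eq`, `gBox_mulVec_eq_zero_of_not_mem`, `proj_mulVec_eq_self`, `nOp_mulVec_eq_zero_of_not_mem`, `val_blkIter`,
`supDist`-free label lemmas `val_eSite`, `eSite_shift`, `higgsOf_sitesPerDir`, `higgsOf_mesh`).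

WHAT IS PRINTED (verbatim).  [BIJ85] p. 326 [PDF 28]: *«The propagators arising from Δ_k(u_k), under the restriction (7.3.1) on the gauge field,
also satisfy the regularity and decay estimates of [7]. In order to remain within the framework of this reference, we remark that by change of gauge
u_k can be transformed in a local region Λ into a configuration of the form exp[ie_kηA], where A is smooth and small.»*  [7] p. 573 [PDF 3]:
*«Similarly |(D^η_{A,μ}G_k(Ω, A)f)(x)|, |(G_k(Ω, A)(x)| ≦ c₀exp(−δ₀dist(x, supp f))‖f‖_∞ (1.10) for x ∈ Ω, dist(x, Ω^c) ≧ R₀.»*  [B1] p. 610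
[PDF 8]: *«Proposition 2.1. Let a set Ω satisfies Ω = B^k(Ω^{(k)}) and let Ω^{(k)} ⊂ T₁^{(k)} be a sum of big blocks with M sufficiently large.
Further, let a configuration A be regular on Ω in the sense that |(∂^η_μA)(x)| ≦ c(e(L^kε))^{β−1}, x ∈ Ω, μ = 1, …, d, (2.23) … Then for e(L^kε)
sufficiently small … there exist positive constants δ₀, c₀, R₀ independent of A, k, Ω and depending on d, a, M only … |(G_k(Ω, A)f)(x)| ≦
c₀exp(−δ₀dist(x, supp f))‖f‖_∞ (2.25) for x ∈ Ω, dist(x, Ω^c) ≧ R₀.»*; p. 607 [PDF 5]: *«If we rescale (1.11) from the ε-lattice to an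
sε-lattice, … ε replaced by sε, T_ε by T_{sε}»* (1.22); p. 610: *«G_k(Ω, A) = (−Δ^{η,N}_{A,Ω} + m²(L^kε)² + a_kP_k(A))^{−1}. (2.22)»*.
[BIJ88] (2.27) p. 263: the `η`-lattice propagators `G_k(□,u)` with Neumann boundary conditions (p31's `gBox`).

WHAT THIS FILE PROVES (kernel-checked, 0 `sorry`; theorems only — no definition, no `Prop` fact).
* §1 **the `ε`-scaling at FIXED charge for a GENERAL region** (typer's `Params.scaleBy t`; p14's `B1Eq38Rescale.propagatorK_rescale` is `Ω = T`
  with the charge rescaled `e ↦ e_s`, which would make p35's constants `t`-dependent — hence this variant): `segSum_smul`/`contourSum_smul`/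
  `multiContourSum_smul` ((2.3) is linear), `U_scaleBy_div` (`U_{tη}(t⁻¹a) = U_η(a)`), `multiContourSum_scaleBy_div`, `fwdTerm_scaleBy_div`/
  `bwdTerm_scaleBy_div`, `covLaplacianN_apply`, **`covLaplacianN_scaleBy_div`** (`−Δ^{tε,N}_{t⁻¹A,Ω} = t⁻²(−Δ^{ε,N}_{A,Ω})`), `avgQkLin_scaleBy_div`,
  `avgQkAdj_apply`, `avgQkAdj_scaleBy_div`, `projPk_scaleBy_div` (`Q_k`, `Q_k^*`, `P_k` are scale-free), `covOpK_apply`, **`covOpK_scaleBy_div`**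
  (`−Δ^{tε}_{t⁻¹A,Ω} + μ + a_k(L^ktε)^{−2}P_k = t⁻²(−Δ^{ε}_{A,Ω} + t²μ + a_k(L^kε)^{−2}P_k)`), **`propagatorK_scaleBy_div`** ((2.22) form:
  `G^{tε}_k(Ω,t⁻¹A;1) = t²G^{ε}_k(Ω,A;t²)`, `a_k ≧ 0`).
* §2 the hypotheses of Prop. 2.1 through the dictionary: `isBlockUnion_of_bigBlocks` (a big-block union is a `k`-block union), `isBigBlockUnion_regH`
  (`Ω_H` is p35's `IsBigBlockUnion k L^s`), **`supDist_eSite`** ((1.3): `supDist (e x) (e y) = tdist x y`), `chi_smul_eq` (`1_{Ω_H}h_ℝ = h_ℝ`),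
  `support_of_massive_eq`, **`isUnit_nOp_add_mass`** (p31's `nOp (α_kL^{kd}) ε⁻¹ e^{ieεA} k Ω + m²` is invertible on `ℓ²(T^{(0)})` for `m² > 0`,
  `a_k ≧ 0`, `Ω` a `k`-block union — [B1] (2.20)'s existence through `covOpK_rfield` + `HiggsCovariancePos.covOpK_injective`).
* §3 **`norm_massive_solution_le`** — (2.25) transferred to the massive `Setup` problems UNIFORMLY in `m² = t² ∈ (0,1]`: an `Ω`-supported solution of
  `(nOp + t²)ψ = h` obeys `‖ψ(x)‖ ≦ c₀(L^kε)²e^{−D/(4L^sL^k)}M` (p35's inner statement as the hypothesis `hB1`, applied on the torus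
  `(higgsOf P s).scaleBy t` — mesh `tL^kε ≦ 1`, `M = K₀ = L^s`, (2.23) scale-invariant, big blocks / `R₀` / support are labels — and
  `ψ_ℝ = G^ε_k(Ω_H,A_H;t²)h_ℝ = t⁻²·G^{tε}_k(Ω_H,t⁻¹A_H;1)h_ℝ`).
* §4 **`norm_gBox_mulVec_le`** — THE p. 326 SENTENCE, DECAY MEMBER, REGION PROPAGATORS: for `d ≧ 1`, `L ≧ 2`, `a > 0`, `e`, `(c, β)`: `∃ s₀, ∀ s ≧ s₀,
  ∃ c₀ e₁ > 0` such that on every `Setup` torus (`d`, `L`), at every level `1 ≦ k ≦ K` with `k + s ≦ m + K`, `3L^kL^s ≦ 2L^{m+K}`, for every union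
  `Ω` of big blocks (`L^k·L^s` sites per side), every `A` with `L^kε|e|/e_k·|∂A| ≦ ce_k^{β−1}/L^k` on `Ω`, `0 < e_k ≦ e₁`, every `x` with
  `{|y − x| ≦ 2rS + 2L^kL^s(d+1)} ⊂ Ω` and every `f` with `|f| ≦ M` vanishing on `{|z − x| < D}`:
  `‖(G_k(Ω,u)f)(x)‖ ≦ c₀(L^kε)²·exp(−D/(4L^s·L^k))·M` — p35's theorem BY NAME at `m² = 1`, `ε₀ = 1`, `N = 2`, `K₀ = L^s`; `isUnit_nOp_add_mass`;
  the resolvent identity `G_k(Ω,u)f = ψ_{t²}(1_Ωf) + t²ψ_{t²}(G_k(Ω,u)f)`; `t ↓ 0` (`le_of_forall_pos_le_add`).  **`norm_gBox_apply_le`** — the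
  kernel form `|G_k(Ω,u;x,y)| ≦ c₀(L^kε)²e^{−|x−y|/(4L^sL^k)}` (`f = δ_y`).  v1.1 (append-only): **`norm_gBox_univ_mulVec_le`** /
  **`norm_gBox_univ_apply_le`** — the whole torus `Ω = T^{(0)}` (trivially a big-block union; no `R₀` condition): the same bounds for p31's
  `gBox … k univ` at a regular exponential field.
* §5 (v1.1, append-only) **`norm_propagatorK_region_reg_decay_unifMass`** — p35's [B1] Prop. 2.1 (2.25) region theorem ITSELF with the constants
  `(K₀min, c₀, e₁)` UNIFORM IN THE MASS `m² ∈ (0, 1]` (`∀ m²` moved inside; the print's «depending on d, a, M only», p. 610): from p35's theorem at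
  `m² = 1` by `propagatorK_scaleBy_div` on `P.scaleBy t`, `t² = m²` (mesh `tL^Kε ≦ L^Kε ≦ ε₀`, (2.23) scale-invariant).
HONEST SCOPE.  (i) VALUE member only: the derivative member `|D^η_{A,μ}G_k|` of (1.10)/(2.25), the Hölder member (1.11)/(2.26) and (2.24) are not
treated here (p35/r14's region files carry (2.25) value only).  (ii) `u` is EXACTLY of the form `e^{ieεA}` with a real bond field `A` regular on `Ω`
(the «change of gauge» of the quoted sentence is not performed here; gauge covariance of `gBox` is p31's (5.6.11)–(5.6.12) `eq5611_gBox`).  (iii) The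
prefactor `(L^kε)²` and the rate `1/(4L^s)` per `L^kε`-step are p35's (the print's «c₀, δ₀ depending on d, a, M only», `M = L^s`); the threshold
`e₁` and `s₀ = K₀min` are p35's existential constants.  (iv) `N = 2` (abelian Higgs), `Ω` a big-block union with `R₀` in the site form
`{|y − x| ≦ 2rS + 2L^kL^s(d+1)} ⊂ Ω`, (2.23) used on `Ω` only — all as in p35's file.
Unit `lit-balaban-r01` gen 25 (literature-prover-lit-balaban-r01-g25-0); v1.0 = p344821 (a8645f2a4324), v1.1 = §4 whole-torus corollaries + §5.
-/

namespace Literature.MathematicalPhysics.QuantumFieldTheory.BalabanImbrieJaffe1984to88.BIJ85NeumannPropagatorRegularDecay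

open Literature.MathematicalPhysics.QuantumFieldTheory.Balaban1983to89
open HiggsLattice (ChargeData)
open HiggsAveraging (toFinest blockIter blockK segSum contourSum multiContourSum avgQk_apply mem_blockK)
open HiggsCovariance (covLaplacianN covOpK propagatorK avgQkLin avgQkAdj projPk fwdTerm bwdTerm avgQkLin_apply)
open HiggsCovarianceCont (fwdTerm_apply bwdTerm_apply)
open HiggsCovariancePos (covOpK_injective isUnit_covOpK propagatorK_covOpK_apply covOpK_propagatorK_apply)
open HiggsRescaling (mesh_scaleBy)
open BIJ85CovariantHiggsDictionary
open BIJ88Sect3Statements (U1)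
open BIJ88NeumannPropagator227Torus (nOp nPad gBox proj proj_mulVec nOp_mul_gBox isUnit_nPad)
open BIJ88NeumannNoZeroModesTorus (IsBlockUnion)
open scoped BigOperators Matrix
open Finset Matrix

noncomputable section

/-! ## §1 The `ε`-scaling `ε ↦ tε`, `A ↦ t⁻¹A` at FIXED charge, for a general region `Ω` -/

section Scaling

variable {Q : HiggsLattice.Params} {N : ℕ} {t : ℝ}

/-- kernel: (2.3) is homogeneous in `A` along a segment. [cite: Balaban1982Higgs1, (2.3) p.608] -/
theorem segSum_smul (c : ℝ) (A : HiggsLattice.VecField Q 0) (u : HiggsLattice.Site Q 0) (μ : Fin Q.d) (n : ℕ) :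
    segSum (c • A) u μ n = c * segSum A u μ n := by
  simp [segSum, Finset.mul_sum]

/-- kernel: (2.3) is homogeneous in `A` along a staircase contour. [cite: Balaban1982Higgs1, (2.3) p.608] -/
theorem contourSum_smul (c : ℝ) (A : HiggsLattice.VecField Q 0) (y x : HiggsLattice.Site Q 0) :
    contourSum (c • A) y x = c * contourSum A y x := by
  simp [contourSum, segSum_smul, Finset.mul_sum]

/-- kernel: `(cA)(Γ^{(k)}_{x_k,x}) = c·A(Γ^{(k)}_{x_k,x})`. [cite: Balaban1982Higgs1, (2.2) p.608] -/
theorem multiContourSum_smul (c : ℝ) (A : HiggsLattice.VecField Q 0) (k : ℕ) (x : HiggsLattice.Site Q 0) :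
    multiContourSum (c • A) k x = c * multiContourSum A k x := by
  simp [multiContourSum, contourSum_smul, Finset.mul_sum]

/-- kernel: the block points `x ↦ x_k` do not involve the spacing (= `HiggsBackgroundRescale.blockIter_scaleBy`, re-proved to keep the
import closure small). [cite: Balaban1982Higgs1, (1.22) p.607] -/
private theorem blockIter_scaleBy (ht : 0 < t) : ∀ (k : ℕ) (x : HiggsLattice.Site Q 0),
    blockIter (P := Q.scaleBy t ht) k x = blockIter (P := Q) k x
  | 0, _ => rfl
  | k + 1, x => by
    show HiggsLattice.blockOf (P := Q.scaleBy t ht) (blockIter (P := Q.scaleBy t ht) k x) = HiggsLattice.blockOf (blockIter k x)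
    rw [blockIter_scaleBy ht k x]
    rfl

/-- kernel: the blocks `B^k(y)` do not involve the spacing (= `HiggsBackgroundRescale.blockK_scaleBy`). [cite: Balaban1982Higgs1, (1.22) p.607] -/
private theorem blockK_scaleBy (ht : 0 < t) (k : ℕ) (y : HiggsLattice.Site Q k) :
    blockK (P := Q.scaleBy t ht) k y = blockK (P := Q) k y := by
  ext x
  exact ⟨fun hx => (mem_blockK (P := Q) k y x).2
      ((blockIter_scaleBy (Q := Q) ht k x).symm.trans ((mem_blockK (P := Q.scaleBy t ht) k y x).1 hx)),
    fun hx => (mem_blockK (P := Q.scaleBy t ht) k y x).2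
      ((blockIter_scaleBy (Q := Q) ht k x).trans ((mem_blockK (P := Q) k y x).1 hx))⟩

/-- **THE TRANSPORTS ARE SCALE-FREE AT FIXED CHARGE**: `U_{tη}(t⁻¹a) = exp(q·(tη)e(t⁻¹a)) = exp(q·ηea) = U_η(a)` — on the `tε`-lattice the
divided bond variable `t⁻¹A` gives the same link operator ([B1] (1.7) `U(A) = exp(qεeA)`; (1.22) p.607 «T_ε by T_{sε}»).
[cite: Balaban1982Higgs1, (1.22) p.607] -/
theorem U_scaleBy_div (ht : 0 < t) (C : ChargeData N) (j : ℕ) (a : ℝ) :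
    C.U ((Q.scaleBy t ht).mesh j) (t⁻¹ * a) = C.U (Q.mesh j) a := by
  rw [mesh_scaleBy]
  unfold ChargeData.U
  congr 2
  field_simp

/-- kernel: `(t⁻¹A)(Γ^{(k)}_{x_k,x})` on the `tε`-lattice is `t⁻¹·A(Γ^{(k)}_{x_k,x})` (same labels, same contours). [cite: Balaban1982Higgs1, (2.2) p.608] -/
theorem multiContourSum_scaleBy_div (ht : 0 < t) (A : HiggsLattice.VecField Q 0) (k : ℕ) (x : HiggsLattice.Site Q 0) :
    multiContourSum (P := Q.scaleBy t ht) (fun b => t⁻¹ * A ⟨b.src, b.dir⟩) k x = t⁻¹ * multiContourSum A k x := by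
  rw [← multiContourSum_smul]
  unfold multiContourSum
  refine Finset.sum_congr rfl fun j _ => ?_
  rw [blockIter_scaleBy ht (j + 1) x, blockIter_scaleBy ht j x]
  rfl

/-- kernel: one forward Neumann term is scale-free at fixed charge. [cite: Balaban1982Higgs1, (2.17) p.610] -/
theorem fwdTerm_scaleBy_div (ht : 0 < t) (C : ChargeData N) (Ω : Finset (HiggsLattice.Site Q 0)) (A : HiggsLattice.VecField Q 0)
    (x : HiggsLattice.Site Q 0) (μ : Fin Q.d) (Φ : HiggsLattice.ScalarField Q 0 N) :
    fwdTerm (P := Q.scaleBy t ht) C Ω (fun b => t⁻¹ * A ⟨b.src, b.dir⟩) x μ Φ = fwdTerm (P := Q) C Ω A x μ Φ := by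
  rw [fwdTerm_apply, fwdTerm_apply]
  show (if x ∈ Ω ∧ x.shift μ ∈ Ω then Φ x - C.U ((Q.scaleBy t ht).mesh 0) (t⁻¹ * A ⟨x, μ⟩) (Φ (x.shift μ)) else 0) = _
  rw [U_scaleBy_div]

/-- kernel: one backward Neumann term is scale-free at fixed charge. [cite: Balaban1982Higgs1, (2.17) p.610] -/
theorem bwdTerm_scaleBy_div (ht : 0 < t) (C : ChargeData N) (Ω : Finset (HiggsLattice.Site Q 0)) (A : HiggsLattice.VecField Q 0)
    (x : HiggsLattice.Site Q 0) (μ : Fin Q.d) (Φ : HiggsLattice.ScalarField Q 0 N) :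
    bwdTerm (P := Q.scaleBy t ht) C Ω (fun b => t⁻¹ * A ⟨b.src, b.dir⟩) x μ Φ = bwdTerm (P := Q) C Ω A x μ Φ := by
  rw [bwdTerm_apply, bwdTerm_apply]
  show (if x ∈ Ω ∧ x.unshift μ ∈ Ω then Φ x - C.U ((Q.scaleBy t ht).mesh 0) (-(t⁻¹ * A ⟨x.unshift μ, μ⟩)) (Φ (x.unshift μ)) else 0) = _
  rw [show -(t⁻¹ * A ⟨x.unshift μ, μ⟩) = t⁻¹ * (-A ⟨x.unshift μ, μ⟩) by ring, U_scaleBy_div]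

/-- kernel: the entrywise covariant Neumann Laplacian. [cite: Balaban1982Higgs1, (2.17) p.610] -/
theorem covLaplacianN_apply (C : ChargeData N) (Ω : Finset (HiggsLattice.Site Q 0)) (A : HiggsLattice.VecField Q 0)
    (Φ : HiggsLattice.ScalarField Q 0 N) (x : HiggsLattice.Site Q 0) :
    covLaplacianN C Ω A Φ x = ((Q.mesh 0)⁻¹ ^ 2) • ∑ μ : Fin Q.d, (fwdTerm C Ω A x μ Φ + bwdTerm C Ω A x μ Φ) := by
  simp only [covLaplacianN, LinearMap.pi_apply, LinearMap.smul_apply, LinearMap.coe_sum, Finset.sum_apply, LinearMap.add_apply]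

/-- **THE COVARIANT NEUMANN LAPLACIAN UNDER `ε ↦ tε`, `A ↦ t⁻¹A`** (any region `Ω`, fixed charge): `−Δ^{tε,N}_{t⁻¹A,Ω} = t⁻²·(−Δ^{ε,N}_{A,Ω})`
([B1] (1.23) p.607 — the derivative scales by the spacing; the transports do not change). [cite: Balaban1982Higgs1, (1.23) p.607] -/
theorem covLaplacianN_scaleBy_div (ht : 0 < t) (C : ChargeData N) (Ω : Finset (HiggsLattice.Site Q 0)) (A : HiggsLattice.VecField Q 0)
    (Φ : HiggsLattice.ScalarField Q 0 N) (x : HiggsLattice.Site Q 0) :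
    covLaplacianN (P := Q.scaleBy t ht) C Ω (fun b => t⁻¹ * A ⟨b.src, b.dir⟩) Φ x = t⁻¹ ^ 2 • covLaplacianN (P := Q) C Ω A Φ x := by
  rw [covLaplacianN_apply, covLaplacianN_apply, smul_smul, mesh_scaleBy, mul_inv, mul_pow]
  congr 1
  exact Finset.sum_congr rfl fun μ _ => by rw [fwdTerm_scaleBy_div, bwdTerm_scaleBy_div]

/-- **`Q_k(t⁻¹A)` ON THE `tε`-LATTICE IS `Q_k(A)`** ([B1] (2.11): the weights `L^{−kd}` and the blocks are labels; the transports are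
scale-free). [cite: Balaban1982Higgs1, (2.11) p.609] -/
theorem avgQkLin_scaleBy_div (ht : 0 < t) (C : ChargeData N) (A : HiggsLattice.VecField Q 0) (k : ℕ)
    (Φ : HiggsLattice.ScalarField Q 0 N) (y : HiggsLattice.Site Q k) :
    avgQkLin (P := Q.scaleBy t ht) C (fun b => t⁻¹ * A ⟨b.src, b.dir⟩) k Φ y = avgQkLin (P := Q) C A k Φ y := by
  rw [avgQkLin_apply, avgQk_apply, avgQkLin_apply, avgQk_apply, blockK_scaleBy ht]
  show (((Q.L : ℝ) ^ (k * Q.d))⁻¹) • ∑ x ∈ blockK k y, C.U ((Q.scaleBy t ht).mesh 0)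
      (multiContourSum (P := Q.scaleBy t ht) (fun b => t⁻¹ * A ⟨b.src, b.dir⟩) k x) (Φ x) = _
  refine congrArg _ (Finset.sum_congr rfl fun x _ => ?_)
  rw [multiContourSum_scaleBy_div ht, U_scaleBy_div]

/-- kernel: the entrywise adjoint `(Q_k^*(A)ψ)(x) = U(−A(Γ^{(k)}_{x_k,x}))ψ(x_k)`. [cite: Balaban1982Higgs1, (2.20) p.610] -/
theorem avgQkAdj_apply (C : ChargeData N) (A : HiggsLattice.VecField Q 0) (k : ℕ) (ψ : HiggsLattice.ScalarField Q k N)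
    (x : HiggsLattice.Site Q 0) :
    avgQkAdj C A k ψ x = C.U (Q.mesh 0) (-(multiContourSum A k x)) (ψ (blockIter k x)) := by
  simp [avgQkAdj, ChargeData.star_U]

/-- **`Q_k^*(t⁻¹A)` ON THE `tε`-LATTICE IS `Q_k^*(A)`**. [cite: Balaban1982Higgs1, (2.20) p.610] -/
theorem avgQkAdj_scaleBy_div (ht : 0 < t) (C : ChargeData N) (A : HiggsLattice.VecField Q 0) (k : ℕ)
    (ψ : HiggsLattice.ScalarField Q k N) (x : HiggsLattice.Site Q 0) :
    avgQkAdj (P := Q.scaleBy t ht) C (fun b => t⁻¹ * A ⟨b.src, b.dir⟩) k ψ x = avgQkAdj (P := Q) C A k ψ x := by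
  rw [avgQkAdj_apply, avgQkAdj_apply, multiContourSum_scaleBy_div ht, blockIter_scaleBy ht,
    show -(t⁻¹ * multiContourSum A k x) = t⁻¹ * (-multiContourSum A k x) by ring, U_scaleBy_div]

/-- **`P_k(t⁻¹A) = Q_k^*Q_k` ON THE `tε`-LATTICE IS `P_k(A)`**. [cite: Balaban1982Higgs1, (2.20) p.610] -/
theorem projPk_scaleBy_div (ht : 0 < t) (C : ChargeData N) (A : HiggsLattice.VecField Q 0) (k : ℕ)
    (Φ : HiggsLattice.ScalarField Q 0 N) :
    projPk (P := Q.scaleBy t ht) C (fun b => t⁻¹ * A ⟨b.src, b.dir⟩) k Φ = projPk (P := Q) C A k Φ := by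
  have h1 : avgQkLin (P := Q.scaleBy t ht) C (fun b => t⁻¹ * A ⟨b.src, b.dir⟩) k Φ = avgQkLin (P := Q) C A k Φ :=
    funext fun y => avgQkLin_scaleBy_div ht C A k Φ y
  unfold projPk
  rw [LinearMap.comp_apply, LinearMap.comp_apply, h1]
  exact funext fun x => avgQkAdj_scaleBy_div ht C A k _ x

/-- kernel: the operator of (2.20) entrywise. [cite: Balaban1982Higgs1, (2.20) p.610] -/
theorem covOpK_apply (C : ChargeData N) (Ω : Finset (HiggsLattice.Site Q 0)) (A : HiggsLattice.VecField Q 0) (μsq a : ℝ) (k : ℕ)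
    (Φ : HiggsLattice.ScalarField Q 0 N) (x : HiggsLattice.Site Q 0) :
    covOpK C Ω A μsq a k Φ x
      = covLaplacianN C Ω A Φ x + μsq • Φ x + (B1.aSeq a Q.L k * (Q.mesh k)⁻¹ ^ 2) • projPk C A k Φ x := rfl

/-- **THE OPERATOR OF [B1] (2.20) UNDER `ε ↦ tε`, `A ↦ t⁻¹A` AT FIXED CHARGE, ANY REGION**:
`−Δ^{tε,N}_{t⁻¹A,Ω} + μ + a_k(L^ktε)^{−2}P_k(t⁻¹A) = t⁻²·(−Δ^{ε,N}_{A,Ω} + t²μ + a_k(L^kε)^{−2}P_k(A))` — the mass is the only scale.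
[cite: Balaban1982Higgs1, (2.22) p.610] -/
theorem covOpK_scaleBy_div (ht : 0 < t) (C : ChargeData N) (Ω : Finset (HiggsLattice.Site Q 0)) (A : HiggsLattice.VecField Q 0)
    (μsq a : ℝ) (k : ℕ) (Φ : HiggsLattice.ScalarField Q 0 N) :
    covOpK (P := Q.scaleBy t ht) C Ω (fun b => t⁻¹ * A ⟨b.src, b.dir⟩) μsq a k Φ
      = t⁻¹ ^ 2 • covOpK (P := Q) C Ω A (t ^ 2 * μsq) a k Φ := by
  funext x
  have ht0 : t ≠ 0 := ht.ne'
  have e1 : t⁻¹ ^ 2 * (t ^ 2 * μsq) = μsq := by field_simp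
  have e2 : B1.aSeq a ((Q.scaleBy t ht).L : ℝ) k * ((Q.scaleBy t ht).mesh k)⁻¹ ^ 2
      = t⁻¹ ^ 2 * (B1.aSeq a Q.L k * (Q.mesh k)⁻¹ ^ 2) := by
    rw [mesh_scaleBy, show ((Q.scaleBy t ht).L : ℝ) = Q.L from rfl, mul_inv, mul_pow]; ring
  rw [Pi.smul_apply, covOpK_apply (Q := Q.scaleBy t ht) C Ω (fun b => t⁻¹ * A ⟨b.src, b.dir⟩) μsq a k Φ x,
    covOpK_apply (Q := Q) C Ω A (t ^ 2 * μsq) a k Φ x, covLaplacianN_scaleBy_div ht C Ω A Φ x, projPk_scaleBy_div ht C A k Φ,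
    smul_add, smul_add, smul_smul, smul_smul, e1, e2]

/-- **THE PROPAGATOR OF [B1] (2.20) UNDER `ε ↦ tε`, `A ↦ t⁻¹A` AT FIXED CHARGE, ANY REGION** — the form of (2.22) p.610 used here:
`G^{tε}_k(Ω, t⁻¹A; m² = 1) = t²·G^{ε}_k(Ω, A; m² = t²)` (`t > 0`, `a_k ≧ 0`). [cite: Balaban1982Higgs1, (2.22) p.610] -/
theorem propagatorK_scaleBy_div (ht : 0 < t) (C : ChargeData N) (Ω : Finset (HiggsLattice.Site Q 0)) (A : HiggsLattice.VecField Q 0)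
    (a : ℝ) (k : ℕ) (hak : 0 ≤ B1.aSeq a Q.L k) (Ψ : HiggsLattice.ScalarField Q 0 N) :
    propagatorK (P := Q.scaleBy t ht) C Ω (fun b => t⁻¹ * A ⟨b.src, b.dir⟩) 1 a k Ψ
      = t ^ 2 • propagatorK (P := Q) C Ω A (t ^ 2) a k Ψ := by
  have ht2 : 0 < t ^ 2 := pow_pos ht 2
  set h := propagatorK (P := Q) C Ω A (t ^ 2) a k Ψ with hh
  have hΨ : Ψ = covOpK (P := Q) C Ω A (t ^ 2) a k h := (covOpK_propagatorK_apply C Ω A ht2 a k hak Ψ).symm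
  have hlin := (covOpK (P := Q.scaleBy t ht) C Ω (fun b => t⁻¹ * A ⟨b.src, b.dir⟩) 1 a k).map_smul (t ^ 2) h
  have e2 : t ^ 2 • covOpK (P := Q.scaleBy t ht) C Ω (fun b => t⁻¹ * A ⟨b.src, b.dir⟩) 1 a k h = Ψ := by
    funext x
    have h3 := congrFun (covOpK_scaleBy_div ht C Ω A 1 a k h) x
    have h4 := congrFun hΨ x
    show t ^ 2 • covOpK (P := Q.scaleBy t ht) C Ω (fun b => t⁻¹ * A ⟨b.src, b.dir⟩) 1 a k h x = Ψ x
    rw [h3, h4]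
    show t ^ 2 • (t⁻¹ ^ 2 • covOpK (P := Q) C Ω A (t ^ 2 * 1) a k h x) = covOpK (P := Q) C Ω A (t ^ 2) a k h x
    rw [smul_smul, mul_one, show t ^ 2 * t⁻¹ ^ 2 = 1 by field_simp, one_smul]
  have hΨ' := hlin.trans e2
  conv_lhs => rw [← hΨ']
  exact propagatorK_covOpK_apply (P := Q.scaleBy t ht) C Ω _ one_pos a k hak _

end Scaling

/-! ## §2 The hypotheses of [B1] Prop. 2.1 through the dictionary; the massive Neumann problems on the `Setup` torus -/

section Transfer

variable {P : Params} {s : ℕ}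

/-- kernel: a union of BIG blocks (cubes of `L^k·L^s` fine sites on the `L^kL^s`-grid — [B1] p.610 «let Ω^{(k)} ⊂ T₁^{(k)} be a sum of big
blocks») is a union of `k`-blocks (p31's `IsBlockUnion`). [cite: Balaban1982Higgs1, Prop. 2.1 p.610] -/
theorem isBlockUnion_of_bigBlocks {k : ℕ} (hk : 0 + k ≤ P.m + P.K) {Ω : Finset (Balaban1983to89.Site P 0)}
    (hbig : ∀ z z' : Balaban1983to89.Site P 0,
      (∀ μ, (z μ).val / (P.L ^ k * P.L ^ s) = (z' μ).val / (P.L ^ k * P.L ^ s)) → (z ∈ Ω ↔ z' ∈ Ω)) :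
    IsBlockUnion k Ω := by
  intro z hz w hw
  rw [BIJ85BlockAveragesTorusK.mem_blockK] at hw
  refine (hbig z w fun μ => ?_).1 hz
  rw [← Nat.div_div_eq_div_mul, ← Nat.div_div_eq_div_mul, ← val_blkIter hk z μ, ← val_blkIter hk w μ, hw]

/-- kernel: `Ω_H` is a big-block union in the sense of p35's `IsBigBlockUnion k (L^s)` on every rescaled copy of the Higgs torus (labels only).
[cite: Balaban1982Higgs1, Prop. 2.1 p.610] -/
theorem isBigBlockUnion_regH (hs : 0 + s ≤ P.m + P.K) {k : ℕ} {Ω : Finset (Balaban1983to89.Site P 0)}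
    (hbig : ∀ z z' : Balaban1983to89.Site P 0,
      (∀ μ, (z μ).val / (P.L ^ k * P.L ^ s) = (z' μ).val / (P.L ^ k * P.L ^ s)) → (z ∈ Ω ↔ z' ∈ Ω))
    {t : ℝ} (ht : 0 < t) :
    B1TorusRegionHSizes.IsBigBlockUnion (P := (higgsOf P s).scaleBy t ht) k (P.L ^ s) (regH P s hs Ω) := by
  intro y y' hyy'
  exact (mem_regH hs Ω y).trans ((hbig _ _ fun μ => by rw [val_eSite, val_eSite]; exact hyy' μ).trans (mem_regH hs Ω y').symm)

/-- kernel: **the `ℓ^∞` torus distances agree** — [B1] (1.3) `|x − y|` in fine-lattice steps is the same number on both tori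
(`LatticeFieldCalculus.supDist` = `HiggsLattice.Site.tdist` through `e`). [cite: Balaban1982Higgs1, (1.3) p.604, dictionary] -/
theorem supDist_eSite (hs : 0 + s ≤ P.m + P.K) (x y : HiggsLattice.Site (higgsOf P s) 0) :
    LatticeFieldCalculus.supDist (eSite P s rfl hs x) (eSite P s rfl hs y) = HiggsLattice.Site.tdist x y := by
  unfold LatticeFieldCalculus.supDist HiggsLattice.Site.tdist
  refine Finset.sup_congr rfl fun μ _ => ?_
  rw [eSite_apply, eSite_apply, ← map_sub, ← map_sub, ZMod.ringEquivCongr_val, ZMod.ringEquivCongr_val]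

/-- kernel: a source supported in `Ω` is fixed by `1_{Ω_H}` (p35's `chi`; stated for a field `g` of the rescaled torus that agrees with
`h_ℝ` pointwise, so that both sides live on one torus). [cite: Balaban1982Higgs1, (2.25) p.610] -/
theorem chi_smul_eq (hs : 0 + s ≤ P.m + P.K) {Ω : Finset (Balaban1983to89.Site P 0)} {h : Balaban1983to89.Site P 0 → ℂ}
    (hh : ∀ z, z ∉ Ω → h z = 0) {t : ℝ} (ht : 0 < t) (g : HiggsLattice.ScalarField ((higgsOf P s).scaleBy t ht) 0 2)
    (hg : ∀ y, g y = rfield P s hs h y) :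
    B1TorusRegionRop.chi (P := (higgsOf P s).scaleBy t ht) (regH P s hs Ω) • g = g := by
  funext y
  show B1TorusRegionRop.chi (P := (higgsOf P s).scaleBy t ht) (regH P s hs Ω) y • g y = g y
  unfold B1TorusRegionRop.chi
  split_ifs with hy
  · exact one_smul _ _
  · have hy' : eSite P s rfl hs y ∉ Ω := fun h' => hy ((mem_regH hs Ω y).2 h')
    rw [zero_smul, hg, rfield_apply, hh _ hy', map_zero]

/-- kernel: a solution of the massive Neumann problem `(−Δ^N_{u,Ω} + α_kL^{kd}Q_k|_Ω^*Q_k|_Ω + m²)ψ = f` with `f` supported in `Ω` is supported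
in `Ω` (the operator lives on `ℓ²(Ω)`, p31 `proj_mul_nOp`). [cite: BalabanImbrieJaffe1988, (2.27) p.263] -/
theorem support_of_massive_eq {k : ℕ} (a c : ℝ) (U : GaugeField P 0 U1) (Ω : Finset (Balaban1983to89.Site P 0)) {m : ℂ} (hm : m ≠ 0)
    {ψ f : Balaban1983to89.Site P 0 → ℂ} (hf : ∀ z, z ∉ Ω → f z = 0) (heq : nOp a c U k Ω *ᵥ ψ + m • ψ = f) :
    ∀ z, z ∉ Ω → ψ z = 0 := fun z hz => by
  have h1 := congrFun heq z
  rw [Pi.add_apply, Pi.smul_apply, nOp_mulVec_eq_zero_of_not_mem a c U Ω ψ hz, zero_add, hf z hz, smul_eq_mul] at h1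
  exact (mul_eq_zero.1 h1).resolve_left hm

/-- **THE MASSIVE NEUMANN PROBLEM ON THE `Setup` TORUS IS UNIQUELY SOLVABLE**: for `m² > 0`, `a_k ≧ 0` and a `k`-block union `Ω`
(`k + s ≦ m + K`), p31's `nOp (α_kL^{kd}) ε⁻¹ e^{ieεA} k Ω + m²` is invertible on all of `ℓ²(T^{(0)})` — through the dictionary this is the
existence of [B1] (2.20) `G^ε_k(Ω_H, A_H)` (`HiggsCovariancePos.covOpK_injective`) plus `m²·1` off `Ω`. [cite: Balaban1982Higgs1, (2.20) p.610] -/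
theorem isUnit_nOp_add_mass (hs : 0 + s ≤ P.m + P.K) {k : ℕ} (hks : k + s ≤ P.m + P.K) (e : ℝ) (A : PBond P 0 → ℝ)
    {msq : ℝ} (hmsq : 0 < msq) {a : ℝ} (hak : 0 ≤ B1.aSeq a (P.L : ℝ) k) {Ω : Finset (Balaban1983to89.Site P 0)}
    (hΩ : IsBlockUnion k Ω) :
    IsUnit (nOp (B1RG242Torus.α P a k * (P.L : ℝ) ^ (k * P.d)) P.eps⁻¹ (expGauge P e A) k Ω
      + (msq : ℂ) • (1 : Matrix (Balaban1983to89.Site P 0) (Balaban1983to89.Site P 0) ℂ)) := by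
  rw [← Matrix.mulVec_injective_iff_isUnit]
  intro φ₁ φ₂ h12
  have happ : ∀ φ : Balaban1983to89.Site P 0 → ℂ,
      (nOp (B1RG242Torus.α P a k * (P.L : ℝ) ^ (k * P.d)) P.eps⁻¹ (expGauge P e A) k Ω
          + (msq : ℂ) • (1 : Matrix (Balaban1983to89.Site P 0) (Balaban1983to89.Site P 0) ℂ)) *ᵥ φ
        = nOp (B1RG242Torus.α P a k * (P.L : ℝ) ^ (k * P.d)) P.eps⁻¹ (expGauge P e A) k Ω *ᵥ φ + (msq : ℂ) • φ :=
    fun φ => by rw [add_mulVec, smul_mulVec, one_mulVec]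
  have hφ : nOp (B1RG242Torus.α P a k * (P.L : ℝ) ^ (k * P.d)) P.eps⁻¹ (expGauge P e A) k Ω *ᵥ (φ₁ - φ₂)
      + (msq : ℂ) • (φ₁ - φ₂) = 0 := by
    have h12' := h12
    rw [happ, happ] at h12'
    rw [mulVec_sub, smul_sub, sub_add_sub_comm, h12', sub_self]
  have hoff : ∀ z, z ∉ Ω → (φ₁ - φ₂) z = 0 :=
    support_of_massive_eq _ _ _ Ω (Complex.ofReal_ne_zero.2 hmsq.ne') (fun _ _ => rfl) hφ
  have hc := covOpK_rfield hs hks e A msq a hΩ hoff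
  rw [hφ] at hc
  have h0 : rfield P s hs (0 : Balaban1983to89.Site P 0 → ℂ) = 0 :=
    funext fun x => by rw [rfield_apply, Pi.zero_apply, map_zero, Pi.zero_apply]
  rw [h0, ← (HiggsCovariance.covOpK (rotCharge e) (regH P s hs Ω) (vecH P s hs A) msq a k).map_zero] at hc
  have hinj := covOpK_injective (rotCharge e) (regH P s hs Ω) (vecH P s hs A) hmsq a k hak hc
  exact sub_eq_zero.1 (rfield_injective hs (hinj.trans h0.symm))

end Transfer

/-! ## §3 [B1] (2.25) at (2.23)-regular `A`, transferred to the massive `Setup` problems at every `m² ∈ (0, 1]` -/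

section Massive

variable {P : Params} {s : ℕ}

/-- **THE DECAY OF THE MASSIVE SOLUTIONS, UNIFORMLY IN `m² = t² ∈ (0,1]`**: if p35's [B1] Prop. 2.1 (2.25) value bound holds with the constants
`(L^s, c₀, e₁)` at `m² = 1`, mesh cap `1` (hypothesis `hB1` — the inner statement of `B1Ineq225RegularRegion.norm_propagatorK_region_reg_decay_sum`,
discharged BY NAME in `norm_gBox_mulVec_le`), then on a `Setup` torus with `L`, `d` as there, for a big-block union `Ω` (blocks `L^k·L^s`), a
(2.23)-regular `A` on `Ω` (`0 < e_k ≦ e₁`), a site `x` with `{|y − x| ≦ 2rS + 2L^kL^s(d+1)} ⊂ Ω` and an `Ω`-supported solution of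
`(nOp (α_kL^{kd}) ε⁻¹ e^{ieεA} k Ω + t²)ψ = h` (`h` supported in `Ω`, `|h| ≦ M`, `h = 0` within distance `< D` of `x`):
`‖ψ(x)‖ ≦ c₀(L^kε)²e^{−D/(4L^sL^k)}M` — by the ε-scaling `t`: `ψ_ℝ = G^ε_k(Ω_H,A_H;t²)h_ℝ = t⁻²G^{tε}_k(Ω_H,t⁻¹A_H;1)h_ℝ` and (2.25) on the
`tε`-torus (mesh `tL^kε ≦ 1`, (2.23) scale-invariant). [cite: Balaban1982Higgs1, (2.25) p.610] -/
theorem norm_massive_solution_le (d L s : ℕ) {a : ℝ} (ha : 0 < a) (e creg β c₀ e₁ : ℝ)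
    (hB1 : ∀ (P' : HiggsLattice.Params), P'.d = d → P'.L = L → L ^ s ∣ P'.M →
      ∀ {K : ℕ}, 1 ≤ K → K ≤ P'.K → (∀ μ, 3 * B1TorusCubeCover.half P' K (L ^ s) ≤ P'.sitesPerDir 0 μ) → P'.mesh K ≤ 1 →
      ∀ (Ω' : Finset (HiggsLattice.Site P' 0)), B1TorusRegionHSizes.IsBigBlockUnion K (L ^ s) Ω' →
      ∀ (A' : HiggsLattice.VecField P' 0) {ec : ℝ}, 0 < ec → ec ≤ e₁ →
      (∀ z ∈ Ω', ∀ μ ν : Fin P'.d,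
          P'.mesh K * |(rotCharge e).e| / ec * |A' ⟨z.shift μ, ν⟩ - A' ⟨z, ν⟩| ≤ creg * ec ^ (β - 1) / (P'.L : ℝ) ^ K) →
      ∀ (x : HiggsLattice.Site P' 0),
        (∀ y, HiggsLattice.Site.tdist x y
            ≤ 2 * B1TorusCubeLocality26.rS P' K (L ^ s) + 2 * B1TorusCubeCover.half P' K (L ^ s) * (P'.d + 1) → y ∈ Ω') →
        ∀ (g : HiggsLattice.ScalarField P' 0 2) (M D : ℝ), (∀ y, ‖g y‖ ≤ M) → 0 ≤ D →
          (∀ z, g z ≠ 0 → D ≤ (HiggsLattice.Site.tdist x z : ℝ)) →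
            ‖propagatorK (rotCharge e) Ω' A' 1 a K (B1TorusRegionRop.chi Ω' • g) x‖
              ≤ c₀ * P'.mesh K ^ 2 * Real.exp (-(D / (4 * (L ^ s : ℕ) * (P'.L : ℝ) ^ K))) * M)
    (P : Params) (hPd : P.d = d) (hPL : P.L = L) (hs : 0 + s ≤ P.m + P.K) {k : ℕ} (hk1 : 1 ≤ k) (hkK : k ≤ P.K)
    (hks : k + s ≤ P.m + P.K) (hsize : 3 * (L ^ k * L ^ s) ≤ P.sitesPerDir 0)
    {Ω : Finset (Balaban1983to89.Site P 0)}
    (hbig : ∀ z z' : Balaban1983to89.Site P 0,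
      (∀ μ, (z μ).val / (L ^ k * L ^ s) = (z' μ).val / (L ^ k * L ^ s)) → (z ∈ Ω ↔ z' ∈ Ω))
    (A : PBond P 0 → ℝ) {ec : ℝ} (hec : 0 < ec) (hece : ec ≤ e₁)
    (hreg : ∀ z ∈ Ω, ∀ μ ν : Fin P.d,
      P.spacing k * |e| / ec * |A ⟨z.shift μ, ν⟩ - A ⟨z, ν⟩| ≤ creg * ec ^ (β - 1) / (L : ℝ) ^ k)
    (x : Balaban1983to89.Site P 0)
    (hint : ∀ y, LatticeFieldCalculus.supDist x y ≤ 2 * (5 * (L ^ k * L ^ s) / 8 + L ^ k) + 2 * (L ^ k * L ^ s) * (d + 1) → y ∈ Ω)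
    {t : ℝ} (ht : 0 < t) (ht1 : t ≤ 1) {ψ h : Balaban1983to89.Site P 0 → ℂ} (hψ : ∀ z, z ∉ Ω → ψ z = 0)
    (hh : ∀ z, z ∉ Ω → h z = 0)
    (heq : nOp (B1RG242Torus.α P a k * (P.L : ℝ) ^ (k * P.d)) P.eps⁻¹ (expGauge P e A) k Ω *ᵥ ψ + ((t ^ 2 : ℝ) : ℂ) • ψ = h)
    (M D : ℝ) (hM : ∀ z, ‖h z‖ ≤ M) (hD : 0 ≤ D) (hsupp : ∀ z, h z ≠ 0 → D ≤ (LatticeFieldCalculus.supDist x z : ℝ)) :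
    ‖ψ x‖ ≤ c₀ * P.spacing k ^ 2 * Real.exp (-(D / (4 * (L : ℝ) ^ s * (L : ℝ) ^ k))) * M := by
  subst hPd hPL
  have hak : 0 ≤ B1.aSeq a (P.L : ℝ) k := (B1.aSeq_pos ha (B1RG242Torus.one_lt_cast_L P) hk1).le
  have hΩ : IsBlockUnion k Ω := isBlockUnion_of_bigBlocks (s := s) (by omega) hbig
  -- the site `x` read on the Higgs torus
  obtain ⟨xH, rfl⟩ : ∃ xH, eSite P s rfl hs xH = x := ⟨(eSite P s rfl hs).symm x, Equiv.apply_symm_apply _ _⟩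
  -- (2.20): the realified solution is the [B1] propagator column at `m² = t²`
  have hcol := propagatorK_rfield_eq hs hks e A (pow_pos ht 2) hak hΩ hψ heq
  -- the ε-scaling to `m² = 1`
  have hsc := propagatorK_scaleBy_div (Q := higgsOf P s) ht (rotCharge e) (regH P s hs Ω) (vecH P s hs A) a k hak (rfield P s hs h)
  -- [B1] (2.25) on the `tε`-torus
  have hb := hB1 ((higgsOf P s).scaleBy t ht) rfl rfl (dvd_refl _) hk1 (show k ≤ P.m + P.K - s by omega)
    (fun μ => by
      rw [show ((higgsOf P s).scaleBy t ht).sitesPerDir 0 μ = P.sitesPerDir 0 from higgsOf_sitesPerDir hs μ]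
      exact hsize)
    (by
      rw [mesh_scaleBy, higgsOf_mesh]
      refine mul_le_one₀ ht1 (P.spacing_pos k).le ?_
      rw [← P.spacing_K]
      exact mul_le_mul_of_nonneg_right (pow_le_pow_right₀ (B1RG242Torus.one_lt_cast_L P).le hkK) P.eps_pos.le)
    (regH P s hs Ω) (isBigBlockUnion_regH hs hbig ht) (fun b => t⁻¹ * vecH P s hs A ⟨b.src, b.dir⟩) hec hece
    (fun z hz μ ν => by
      have hz' : eSite P s rfl hs z ∈ Ω := (mem_regH hs Ω z).1 hz
      rw [mesh_scaleBy, higgsOf_mesh, rotCharge_e]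
      show t * P.spacing k * |e| / ec * |t⁻¹ * vecH P s hs A ⟨HiggsLattice.Site.shift (P := higgsOf P s) z μ, ν⟩
          - t⁻¹ * vecH P s hs A ⟨z, ν⟩| ≤ creg * ec ^ (β - 1) / (P.L : ℝ) ^ k
      rw [vecH_apply, vecH_apply, eSite_shift, ← mul_sub, abs_mul, abs_of_pos (inv_pos.2 ht),
        show t * P.spacing k * |e| / ec * (t⁻¹ * |A ⟨(eSite P s rfl hs z).shift μ, ν⟩ - A ⟨eSite P s rfl hs z, ν⟩|)
          = P.spacing k * |e| / ec * |A ⟨(eSite P s rfl hs z).shift μ, ν⟩ - A ⟨eSite P s rfl hs z, ν⟩| by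
            field_simp]
      exact hreg _ hz' μ ν)
    xH
    (fun y hy => (mem_regH hs Ω y).2 (hint _ (by
      rw [supDist_eSite]
      exact hy)))
    (rfield P s hs h) M D (fun y => by rw [norm_rfield_apply]; exact hM _) hD
    (fun z hz => by
      have hz' : h (eSite P s rfl hs z) ≠ 0 := fun h0 => hz (by rw [rfield_apply, h0, map_zero])
      have := hsupp _ hz'
      rw [supDist_eSite] at this
      exact this)
  -- assemble
  have hchi := chi_smul_eq hs hh ht (Ω := Ω) (rfield P s hs h) fun _ => rfl
  rw [hchi] at hb
  have hb' : ‖propagatorK (P := (higgsOf P s).scaleBy t ht) (rotCharge e) (regH P s hs Ω)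
      (fun b => t⁻¹ * vecH P s hs A ⟨b.src, b.dir⟩) 1 a k (rfield P s hs h) xH‖
        ≤ c₀ * ((higgsOf P s).scaleBy t ht).mesh k ^ 2
          * Real.exp (-(D / (4 * (P.L ^ s : ℕ) * (((higgsOf P s).scaleBy t ht).L : ℝ) ^ k))) * M := hb
  rw [mesh_scaleBy, higgsOf_mesh, Nat.cast_pow, show (((higgsOf P s).scaleBy t ht).L : ℝ) = P.L from rfl] at hb'
  have hval : ψ (eSite P s rfl hs xH)
      = toE.symm (t⁻¹ ^ 2 • propagatorK (P := (higgsOf P s).scaleBy t ht) (rotCharge e) (regH P s hs Ω)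
          (fun b => t⁻¹ * vecH P s hs A ⟨b.src, b.dir⟩) 1 a k (rfield P s hs h) xH) := by
    have h1 := congrFun hcol xH
    have h2 := congrFun hsc xH
    rw [rfield_apply] at h1
    apply toE.injective
    rw [LinearIsometryEquiv.apply_symm_apply, ← h1]
    show _ = t⁻¹ ^ 2 • (propagatorK (P := (higgsOf P s).scaleBy t ht) (rotCharge e) (regH P s hs Ω)
          (fun b => t⁻¹ * vecH P s hs A ⟨b.src, b.dir⟩) 1 a k (rfield P s hs h)) xH
    rw [h2]
    show _ = t⁻¹ ^ 2 • (t ^ 2 • (propagatorK (rotCharge e) (regH P s hs Ω) (vecH P s hs A) (t ^ 2) a k) (rfield P s hs h) xH)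
    rw [smul_smul, show t⁻¹ ^ 2 * t ^ 2 = 1 by field_simp, one_smul]
  rw [hval, LinearIsometryEquiv.norm_map, norm_smul, Real.norm_of_nonneg (pow_nonneg (inv_pos.2 ht).le 2)]
  calc t⁻¹ ^ 2 * _ ≤ t⁻¹ ^ 2 * (c₀ * (t * P.spacing k) ^ 2 * Real.exp (-(D / (4 * (P.L : ℝ) ^ s * (P.L : ℝ) ^ k))) * M) :=
        mul_le_mul_of_nonneg_left hb' (pow_nonneg (inv_pos.2 ht).le 2)
    _ = _ := by field_simp

end Massive

/-! ## §4 [BIJ85] p.326: the decay estimate (1.10) of [7] for the region Neumann propagators `G_k(Ω,u)` at `u = e^{ieεA}`, `A` regular -/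

section Decay

/-- **[BalabanImbrieJaffe1985] p.326 «The propagators arising from Δ_k(u_k) … also satisfy the regularity and decay estimates of [7]. In order to
remain within the framework of this reference, we remark that by change of gauge u_k can be transformed in a local region Λ into a configuration of the
form exp[ie_kηA], where A is smooth and small.» — THE DECAY MEMBER, FOR THE REGION NEUMANN PROPAGATORS `G_k(Ω,u)` OF [BalabanImbrieJaffe1988]
(2.27)/(5.6.10) AT `u = e^{ieεA}`.**  [7] Theorem p.573 (1.10) = [B1] Prop. 2.1 (2.25), value member: for `d ≧ 1`, `L ≧ 2`, `a > 0`, a charge `e`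
and a regularity pair `(c, β)` there are a minimal big-block exponent `s₀` and, for every `s ≧ s₀`, constants `c₀, e₁ > 0` (depending on `d, a, L^s`
only) such that on every torus `T^{(0)} = (ℤ/2L^{m+K})^d`, `ε = L^{−K}`, at every level `1 ≦ k ≦ K` with `k + s ≦ m + K`, `3L^kL^s ≦ 2L^{m+K}`, for
every union `Ω` of big blocks (cubes of `L^k·L^s` sites on the `L^kL^s`-grid), every real bond field `A` with
`L^kε·|e|/e_k·|A(⟨x+e_μ,ν⟩) − A(⟨x,ν⟩)| ≦ c·e_k^{β−1}/L^k` on `Ω` ((2.23), `0 < e_k ≦ e₁`), every site `x` with `{y : |y − x| ≦ 2rS + 2L^kL^s(d+1)} ⊂ Ω`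
(`R₀`) and every `f` with `|f| ≦ M`, `f = 0` on `{|z − x| < D}` (only `1_Ωf` matters):
`|(G_k(Ω,u)f)(x)| ≦ c₀(L^kε)²·exp(−D/(4L^s·L^k))·M`, `G_k(Ω,u)` = p31's `gBox (α_kL^{kd}) ε⁻¹ u k Ω`, `u = expGauge e A`, `α_k = a_k(L^kε)^{−2}`.
PROOF (kernel): p35's `B1Ineq225RegularRegion.norm_propagatorK_region_reg_decay_sum` BY NAME at `m² = 1` on the `tε`-tori through the dictionary
(`norm_massive_solution_le`), the massive problems `(nOp + t²)ψ = f` (`isUnit_nOp_add_mass`), the resolvent identity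
`G_k(Ω,u)f = ψ_{t²}(f) + t²ψ_{t²}(G_k(Ω,u)f)` and `t ↓ 0`.  HONEST SCOPE: value member only (the derivative member `|D_{A,μ}G_k|` and the
Hölder member (1.11) are not treated here); `u` exactly of the form `e^{ieεA}` (the gauge change of the quoted sentence is not performed); `N = 2`.
[cite: BalabanImbrieJaffe1985, p.326 «also satisfy the regularity and decay estimates of [7]»] -/
theorem norm_gBox_mulVec_le (d L : ℕ) (hd : 1 ≤ d) (hL : 2 ≤ L) {a : ℝ} (ha : 0 < a) (e creg β : ℝ) (hcreg : 0 ≤ creg)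
    (hβ : 0 < β) :
    ∃ s₀ : ℕ, ∀ s : ℕ, s₀ ≤ s → ∃ c₀ e₁ : ℝ, 0 < c₀ ∧ 0 < e₁ ∧
      ∀ (P : Params), P.d = d → P.L = L → ∀ {k : ℕ}, 1 ≤ k → k ≤ P.K → k + s ≤ P.m + P.K →
      3 * (L ^ k * L ^ s) ≤ P.sitesPerDir 0 →
      ∀ (Ω : Finset (Balaban1983to89.Site P 0)),
        (∀ z z' : Balaban1983to89.Site P 0,
          (∀ μ, (z μ).val / (L ^ k * L ^ s) = (z' μ).val / (L ^ k * L ^ s)) → (z ∈ Ω ↔ z' ∈ Ω)) →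
      ∀ (A : PBond P 0 → ℝ) {ec : ℝ}, 0 < ec → ec ≤ e₁ →
      (∀ z ∈ Ω, ∀ μ ν : Fin P.d,
          P.spacing k * |e| / ec * |A ⟨z.shift μ, ν⟩ - A ⟨z, ν⟩| ≤ creg * ec ^ (β - 1) / (L : ℝ) ^ k) →
      ∀ (x : Balaban1983to89.Site P 0),
        (∀ y, LatticeFieldCalculus.supDist x y ≤ 2 * (5 * (L ^ k * L ^ s) / 8 + L ^ k) + 2 * (L ^ k * L ^ s) * (d + 1) → y ∈ Ω) →
      ∀ (f : Balaban1983to89.Site P 0 → ℂ) (M D : ℝ), (∀ z, ‖f z‖ ≤ M) → 0 ≤ D →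
        (∀ z, f z ≠ 0 → D ≤ (LatticeFieldCalculus.supDist x z : ℝ)) →
        ‖(gBox (B1RG242Torus.α P a k * (P.L : ℝ) ^ (k * P.d)) P.eps⁻¹ (expGauge P e A) k Ω *ᵥ f) x‖
          ≤ c₀ * P.spacing k ^ 2 * Real.exp (-(D / (4 * (L : ℝ) ^ s * (L : ℝ) ^ k))) * M := by
  obtain ⟨K₀min, hK⟩ :=
    B1Ineq225RegularRegion.norm_propagatorK_region_reg_decay_sum d L hd hL ha one_pos 2 (rotCharge e) 1 creg β hcreg hβ
  refine ⟨K₀min, fun s hs₀ => ?_⟩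
  obtain ⟨c₀, e₁, hc₀, he₁, hB1⟩ := hK (L ^ s) (le_trans hs₀ (Nat.lt_pow_self (by omega : 1 < L)).le)
  refine ⟨c₀, e₁, hc₀, he₁, ?_⟩
  intro P hPd hPL k hk1 hkK hks hsize Ω hbig A ec hec hece hreg x hint f₀ M D hM₀ hD hsupp₀
  -- reduce to a source supported in `Ω`: `G_k(Ω,u)·1_Ω = G_k(Ω,u)` (p31 `gBox_mul_proj`)
  rw [show gBox (B1RG242Torus.α P a k * (P.L : ℝ) ^ (k * P.d)) P.eps⁻¹ (expGauge P e A) k Ω *ᵥ f₀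
      = gBox (B1RG242Torus.α P a k * (P.L : ℝ) ^ (k * P.d)) P.eps⁻¹ (expGauge P e A) k Ω *ᵥ (proj Ω *ᵥ f₀) by
    rw [mulVec_mulVec, BIJ88NeumannPropagator227Torus.gBox_mul_proj]]
  set f := proj Ω *ᵥ f₀ with hf_def
  have hf : ∀ z, z ∉ Ω → f z = 0 := fun z hz => by rw [hf_def, proj_mulVec, if_neg hz]
  have hM : ∀ z, ‖f z‖ ≤ M := fun z => by
    rw [hf_def, proj_mulVec]
    split_ifs
    · exact hM₀ z
    · rw [norm_zero]; exact (norm_nonneg _).trans (hM₀ x)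
  have hsupp : ∀ z, f z ≠ 0 → D ≤ (LatticeFieldCalculus.supDist x z : ℝ) := fun z hz => hsupp₀ z (by
    rw [hf_def, proj_mulVec] at hz
    split_ifs at hz with hzΩ
    · exact hz
    · exact absurd rfl hz)
  have hak : 0 ≤ B1.aSeq a (P.L : ℝ) k := (B1.aSeq_pos ha (B1RG242Torus.one_lt_cast_L P) hk1).le
  have hα : 0 < B1RG242Torus.α P a k * (P.L : ℝ) ^ (k * P.d) :=
    mul_pos (mul_pos (B1.aSeq_pos ha (B1RG242Torus.one_lt_cast_L P) hk1) (inv_pos.2 (pow_pos (P.spacing_pos k) 2)))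
      (pow_pos P.cast_L_pos _)
  have hs : 0 + s ≤ P.m + P.K := by omega
  have hbig' : ∀ z z' : Balaban1983to89.Site P 0,
      (∀ μ, (z μ).val / (P.L ^ k * P.L ^ s) = (z' μ).val / (P.L ^ k * P.L ^ s)) → (z ∈ Ω ↔ z' ∈ Ω) := by
    rw [hPL]; exact hbig
  have hΩ : IsBlockUnion k Ω := isBlockUnion_of_bigBlocks (s := s) (by omega) hbig'
  have hN := isUnit_nPad (j := 0) (by omega) (inv_ne_zero P.eps_pos.ne') hα (expGauge P e A) hΩ
  -- `g = G_k(Ω,u)f`: supported in `Ω`, `nOp g = f`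
  set g := gBox (B1RG242Torus.α P a k * (P.L : ℝ) ^ (k * P.d)) P.eps⁻¹ (expGauge P e A) k Ω *ᵥ f with hg
  have hgsupp : ∀ z, z ∉ Ω → g z = 0 := fun z hz => gBox_mulVec_eq_zero_of_not_mem hN f hz
  have hNg : nOp (B1RG242Torus.α P a k * (P.L : ℝ) ^ (k * P.d)) P.eps⁻¹ (expGauge P e A) k Ω *ᵥ g = f := by
    rw [hg, mulVec_mulVec, nOp_mul_gBox hN, proj_mulVec_eq_self hf]
  -- at every `τ = t² ∈ (0,1]`: `g = ψ_f + τψ_g` with the massive solutions, and their bounds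
  have key : ∀ τ : ℝ, 0 < τ → τ ≤ 1 →
      ‖g x‖ ≤ c₀ * P.spacing k ^ 2 * Real.exp (-(D / (4 * (L : ℝ) ^ s * (L : ℝ) ^ k))) * M
        + τ * (c₀ * P.spacing k ^ 2 * Real.exp (-(0 / (4 * (L : ℝ) ^ s * (L : ℝ) ^ k))) * ∑ z, ‖g z‖) := by
    intro τ hτ hτ1
    obtain ⟨t, ht, ht1, htt⟩ : ∃ t : ℝ, 0 < t ∧ t ≤ 1 ∧ t ^ 2 = τ :=
      ⟨Real.sqrt τ, Real.sqrt_pos.2 hτ, by rw [← Real.sqrt_one]; exact Real.sqrt_le_sqrt hτ1, Real.sq_sqrt hτ.le⟩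
    have ht2 : ((t ^ 2 : ℝ) : ℂ) ≠ 0 := Complex.ofReal_ne_zero.2 (pow_pos ht 2).ne'
    have hU := isUnit_nOp_add_mass hs hks e A (pow_pos ht 2) hak hΩ
    have happ : ∀ φ : Balaban1983to89.Site P 0 → ℂ,
        (nOp (B1RG242Torus.α P a k * (P.L : ℝ) ^ (k * P.d)) P.eps⁻¹ (expGauge P e A) k Ω
            + ((t ^ 2 : ℝ) : ℂ) • (1 : Matrix (Balaban1983to89.Site P 0) (Balaban1983to89.Site P 0) ℂ)) *ᵥ φ
          = nOp (B1RG242Torus.α P a k * (P.L : ℝ) ^ (k * P.d)) P.eps⁻¹ (expGauge P e A) k Ω *ᵥ φ + ((t ^ 2 : ℝ) : ℂ) • φ :=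
      fun φ => by rw [add_mulVec, smul_mulVec, one_mulVec]
    obtain ⟨ψf, hTf⟩ := (Matrix.mulVec_surjective_iff_isUnit.2 hU) f
    obtain ⟨ψg, hTg⟩ := (Matrix.mulVec_surjective_iff_isUnit.2 hU) g
    have hψf : nOp (B1RG242Torus.α P a k * (P.L : ℝ) ^ (k * P.d)) P.eps⁻¹ (expGauge P e A) k Ω *ᵥ ψf
        + ((t ^ 2 : ℝ) : ℂ) • ψf = f := by rw [← happ]; exact hTf
    have hψg : nOp (B1RG242Torus.α P a k * (P.L : ℝ) ^ (k * P.d)) P.eps⁻¹ (expGauge P e A) k Ω *ᵥ ψg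
        + ((t ^ 2 : ℝ) : ℂ) • ψg = g := by rw [← happ]; exact hTg
    have hsf := support_of_massive_eq _ _ _ Ω ht2 hf hψf
    have hsg := support_of_massive_eq _ _ _ Ω ht2 hgsupp hψg
    -- the resolvent identity
    have hres : g = ψf + ((t ^ 2 : ℝ) : ℂ) • ψg := by
      apply Matrix.mulVec_injective_iff_isUnit.2 hU
      show _ *ᵥ g = _ *ᵥ (ψf + ((t ^ 2 : ℝ) : ℂ) • ψg)
      rw [mulVec_add, mulVec_smul, hTf, hTg, happ, hNg]
    -- [B1] (2.25) for the two massive solutions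
    have hBf := norm_massive_solution_le d L s ha e creg β c₀ e₁ hB1 P hPd hPL hs hk1 hkK hks hsize hbig A hec hece hreg x hint
      ht ht1 hsf hf hψf M D hM hD hsupp
    have hBg := norm_massive_solution_le d L s ha e creg β c₀ e₁ hB1 P hPd hPL hs hk1 hkK hks hsize hbig A hec hece hreg x hint
      ht ht1 hsg hgsupp hψg (∑ z, ‖g z‖) 0
      (fun z => Finset.single_le_sum (fun w _ => norm_nonneg (g w)) (Finset.mem_univ z)) le_rfl
      (fun z _ => Nat.cast_nonneg _)
    rw [congrFun hres x, Pi.add_apply, Pi.smul_apply]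
    refine (norm_add_le _ _).trans (add_le_add hBf ?_)
    rw [norm_smul, Complex.norm_real, Real.norm_of_nonneg (pow_pos ht 2).le, htt]
    exact mul_le_mul_of_nonneg_left hBg hτ.le
  -- `τ ↓ 0`
  refine le_of_forall_pos_le_add fun ε hε => ?_
  set Bg := c₀ * P.spacing k ^ 2 * Real.exp (-(0 / (4 * (L : ℝ) ^ s * (L : ℝ) ^ k))) * ∑ z, ‖g z‖ with hBg_def
  have hBg0 : 0 ≤ Bg := by positivity
  have h := key (min 1 (ε / (Bg + 1))) (lt_min one_pos (div_pos hε (by linarith))) (min_le_left _ _)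
  refine h.trans (add_le_add le_rfl ?_)
  calc min 1 (ε / (Bg + 1)) * Bg ≤ ε / (Bg + 1) * Bg := mul_le_mul_of_nonneg_right (min_le_right _ _) hBg0
    _ ≤ ε := by
      rw [div_mul_eq_mul_div, div_le_iff₀ (by linarith)]
      nlinarith

/-- **THE KERNEL FORM**: under the same hypotheses, for every `x` with `{|y − x| ≦ 2rS + 2L^kL^s(d+1)} ⊂ Ω` and every site `y`,
`|G_k(Ω,u; x, y)| ≦ c₀(L^kε)²·exp(−|x − y|/(4L^s·L^k))` — [7] Theorem p.573 «|G_k(Ω, A; x, x′)| ≦ c₀ … exp(−δ₀|x − x′|)» (value member, the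
carrier's prefactor `(L^kε)²`, `δ₀ = 1/(4L^s)` per `L^kε`) for the C2 region Neumann propagator at `u = e^{ieεA}`, from `norm_gBox_mulVec_le`
at `f = δ_y`. [cite: Balaban1983RegularityDecay, Theorem p.573 (1.10)] -/
theorem norm_gBox_apply_le (d L : ℕ) (hd : 1 ≤ d) (hL : 2 ≤ L) {a : ℝ} (ha : 0 < a) (e creg β : ℝ) (hcreg : 0 ≤ creg)
    (hβ : 0 < β) :
    ∃ s₀ : ℕ, ∀ s : ℕ, s₀ ≤ s → ∃ c₀ e₁ : ℝ, 0 < c₀ ∧ 0 < e₁ ∧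
      ∀ (P : Params), P.d = d → P.L = L → ∀ {k : ℕ}, 1 ≤ k → k ≤ P.K → k + s ≤ P.m + P.K →
      3 * (L ^ k * L ^ s) ≤ P.sitesPerDir 0 →
      ∀ (Ω : Finset (Balaban1983to89.Site P 0)),
        (∀ z z' : Balaban1983to89.Site P 0,
          (∀ μ, (z μ).val / (L ^ k * L ^ s) = (z' μ).val / (L ^ k * L ^ s)) → (z ∈ Ω ↔ z' ∈ Ω)) →
      ∀ (A : PBond P 0 → ℝ) {ec : ℝ}, 0 < ec → ec ≤ e₁ →
      (∀ z ∈ Ω, ∀ μ ν : Fin P.d,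
          P.spacing k * |e| / ec * |A ⟨z.shift μ, ν⟩ - A ⟨z, ν⟩| ≤ creg * ec ^ (β - 1) / (L : ℝ) ^ k) →
      ∀ (x : Balaban1983to89.Site P 0),
        (∀ y, LatticeFieldCalculus.supDist x y ≤ 2 * (5 * (L ^ k * L ^ s) / 8 + L ^ k) + 2 * (L ^ k * L ^ s) * (d + 1) → y ∈ Ω) →
      ∀ (y : Balaban1983to89.Site P 0),
        ‖gBox (B1RG242Torus.α P a k * (P.L : ℝ) ^ (k * P.d)) P.eps⁻¹ (expGauge P e A) k Ω x y‖
          ≤ c₀ * P.spacing k ^ 2 * Real.exp (-((LatticeFieldCalculus.supDist x y : ℝ) / (4 * (L : ℝ) ^ s * (L : ℝ) ^ k))) := by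
  obtain ⟨s₀, hs₀⟩ := norm_gBox_mulVec_le d L hd hL ha e creg β hcreg hβ
  refine ⟨s₀, fun s hs => ?_⟩
  obtain ⟨c₀, e₁, hc₀, he₁, hmain⟩ := hs₀ s hs
  refine ⟨c₀, e₁, hc₀, he₁, ?_⟩
  intro P hPd hPL k hk1 hkK hks hsize Ω hbig A ec hec hece hreg x hint y
  have h := hmain P hPd hPL hk1 hkK hks hsize Ω hbig A hec hece hreg x hint (Pi.single y 1) 1 (LatticeFieldCalculus.supDist x y)
    (fun z => by
      rw [Pi.single_apply]
      split_ifs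
      · rw [norm_one]
      · rw [norm_zero]; exact zero_le_one)
    (Nat.cast_nonneg _)
    (fun z hz => by
      rw [Pi.single_apply] at hz
      split_ifs at hz with hzy
      · rw [hzy]
      · exact absurd rfl hz)
  rwa [mulVec_single, MulOpposite.op_one, one_smul, Matrix.col_apply, mul_one] at h

/-- **THE WHOLE TORUS `Ω = T^{(0)}`** (trivially a big-block union, no `R₀` condition): for `u = e^{ieεA}` with `A` (2.23)-regular on all of
`T^{(0)}` (`0 < e_k ≦ e₁`), `3L^kL^s ≦ 2L^{m+K}`, every `x` and every `f` with `|f| ≦ M` vanishing on `{|z − x| < D}`: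
`‖(G_k(T,u)f)(x)‖ ≦ c₀(L^kε)²e^{−D/(4L^sL^k)}M` — the decay member of the p. 326 sentence for p31's whole-torus `gBox … k univ = Δ_k(u)⁻¹`-type
propagator `(−Δ_u + α_kL^{kd}Q_k(u)^*Q_k(u))⁻¹` at a regular exponential field (p33's `BIJ85Claim73PropagatorDecay` treats the (4.5.4) background by the
Kato route; p27's `decay110_smallField` the small-field plaquette condition). [cite: BalabanImbrieJaffe1985, p.326 «also satisfy the regularity and decay estimates of [7]»] -/
theorem norm_gBox_univ_mulVec_le (d L : ℕ) (hd : 1 ≤ d) (hL : 2 ≤ L) {a : ℝ} (ha : 0 < a) (e creg β : ℝ) (hcreg : 0 ≤ creg)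
    (hβ : 0 < β) :
    ∃ s₀ : ℕ, ∀ s : ℕ, s₀ ≤ s → ∃ c₀ e₁ : ℝ, 0 < c₀ ∧ 0 < e₁ ∧
      ∀ (P : Params), P.d = d → P.L = L → ∀ {k : ℕ}, 1 ≤ k → k ≤ P.K → k + s ≤ P.m + P.K →
      3 * (L ^ k * L ^ s) ≤ P.sitesPerDir 0 →
      ∀ (A : PBond P 0 → ℝ) {ec : ℝ}, 0 < ec → ec ≤ e₁ →
      (∀ (z : Balaban1983to89.Site P 0) (μ ν : Fin P.d),
          P.spacing k * |e| / ec * |A ⟨z.shift μ, ν⟩ - A ⟨z, ν⟩| ≤ creg * ec ^ (β - 1) / (L : ℝ) ^ k) →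
      ∀ (x : Balaban1983to89.Site P 0) (f : Balaban1983to89.Site P 0 → ℂ) (M D : ℝ), (∀ z, ‖f z‖ ≤ M) → 0 ≤ D →
        (∀ z, f z ≠ 0 → D ≤ (LatticeFieldCalculus.supDist x z : ℝ)) →
        ‖(gBox (B1RG242Torus.α P a k * (P.L : ℝ) ^ (k * P.d)) P.eps⁻¹ (expGauge P e A) k Finset.univ *ᵥ f) x‖
          ≤ c₀ * P.spacing k ^ 2 * Real.exp (-(D / (4 * (L : ℝ) ^ s * (L : ℝ) ^ k))) * M := by
  obtain ⟨s₀, hs₀⟩ := norm_gBox_mulVec_le d L hd hL ha e creg β hcreg hβ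
  refine ⟨s₀, fun s hs => ?_⟩
  obtain ⟨c₀, e₁, hc₀, he₁, hmain⟩ := hs₀ s hs
  refine ⟨c₀, e₁, hc₀, he₁, ?_⟩
  intro P hPd hPL k hk1 hkK hks hsize A ec hec hece hreg x f M D hM hD hsupp
  exact hmain P hPd hPL hk1 hkK hks hsize Finset.univ
    (fun z z' _ => by simp only [Finset.mem_univ]) A hec hece (fun z _ μ ν => hreg z μ ν) x
    (fun y _ => Finset.mem_univ y) f M D hM hD hsupp

/-- **THE WHOLE TORUS, KERNEL FORM**: `|G_k(T,u;x,y)| ≦ c₀(L^kε)²e^{−|x−y|/(4L^sL^k)}` at a regular exponential field `u = e^{ieεA}`.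
[cite: BalabanImbrieJaffe1985, p.326 «also satisfy the regularity and decay estimates of [7]»] -/
theorem norm_gBox_univ_apply_le (d L : ℕ) (hd : 1 ≤ d) (hL : 2 ≤ L) {a : ℝ} (ha : 0 < a) (e creg β : ℝ) (hcreg : 0 ≤ creg)
    (hβ : 0 < β) :
    ∃ s₀ : ℕ, ∀ s : ℕ, s₀ ≤ s → ∃ c₀ e₁ : ℝ, 0 < c₀ ∧ 0 < e₁ ∧
      ∀ (P : Params), P.d = d → P.L = L → ∀ {k : ℕ}, 1 ≤ k → k ≤ P.K → k + s ≤ P.m + P.K →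
      3 * (L ^ k * L ^ s) ≤ P.sitesPerDir 0 →
      ∀ (A : PBond P 0 → ℝ) {ec : ℝ}, 0 < ec → ec ≤ e₁ →
      (∀ (z : Balaban1983to89.Site P 0) (μ ν : Fin P.d),
          P.spacing k * |e| / ec * |A ⟨z.shift μ, ν⟩ - A ⟨z, ν⟩| ≤ creg * ec ^ (β - 1) / (L : ℝ) ^ k) →
      ∀ (x y : Balaban1983to89.Site P 0),
        ‖gBox (B1RG242Torus.α P a k * (P.L : ℝ) ^ (k * P.d)) P.eps⁻¹ (expGauge P e A) k Finset.univ x y‖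
          ≤ c₀ * P.spacing k ^ 2 * Real.exp (-((LatticeFieldCalculus.supDist x y : ℝ) / (4 * (L : ℝ) ^ s * (L : ℝ) ^ k))) := by
  obtain ⟨s₀, hs₀⟩ := norm_gBox_apply_le d L hd hL ha e creg β hcreg hβ
  refine ⟨s₀, fun s hs => ?_⟩
  obtain ⟨c₀, e₁, hc₀, he₁, hmain⟩ := hs₀ s hs
  refine ⟨c₀, e₁, hc₀, he₁, ?_⟩
  intro P hPd hPL k hk1 hkK hks hsize A ec hec hece hreg x y
  exact hmain P hPd hPL hk1 hkK hks hsize Finset.univ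
    (fun z z' _ => by simp only [Finset.mem_univ]) A hec hece (fun z _ μ ν => hreg z μ ν) x
    (fun y _ => Finset.mem_univ y) y

end Decay

/-! ## §5 [B1] Prop. 2.1 (2.25) for regions with constants UNIFORM in the mass `m² ∈ (0, 1]` (the print's «depending on d, a, M only») -/

section UniformMass

/-- **[B1] PROP. 2.1 (2.25), VALUE MEMBER FOR BIG-BLOCK REGIONS, WITH CONSTANTS INDEPENDENT OF `m² ∈ (0,1]`**: p35's
`B1Ineq225RegularRegion.norm_propagatorK_region_reg_decay_sum` produces `K₀min, c₀, e₁` AFTER `m²` is fixed; the print has «positive constants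
δ₀, c₀, R₀ independent of A, k, Ω and depending on d, a, M only» (p. 610).  By the `ε`-scaling at fixed charge (`propagatorK_scaleBy_div`:
`G^ε_k(Ω,A;t²) = t⁻²G^{tε}_k(Ω,t⁻¹A;1)`, mesh `tL^kε ≦ L^kε ≦ ε₀`, (2.23) scale-invariant, big blocks / `R₀` / supports are labels) the constants
of `m² = 1` serve every `m² = t² ∈ (0,1]`: same statement as p35's with `∀ m² ∈ (0,1]` moved INSIDE. [cite: Balaban1982Higgs1, Prop. 2.1 (2.25) p.610] -/
theorem norm_propagatorK_region_reg_decay_unifMass (d L : ℕ) (hd : 1 ≤ d) (hL : 2 ≤ L) {a : ℝ} (ha : 0 < a)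
    (N : ℕ) (C : ChargeData N) (ε₀ : ℝ) (creg β : ℝ) (hcreg : 0 ≤ creg) (hβ : 0 < β) :
    ∃ K₀min : ℕ, ∀ K₀ : ℕ, K₀min ≤ K₀ → ∃ c₀ e₁ : ℝ, 0 < c₀ ∧ 0 < e₁ ∧
      ∀ (P : HiggsLattice.Params), P.d = d → P.L = L → K₀ ∣ P.M →
      ∀ {K : ℕ}, 1 ≤ K → K ≤ P.K → (∀ μ, 3 * B1TorusCubeCover.half P K K₀ ≤ P.sitesPerDir 0 μ) → P.mesh K ≤ ε₀ →
      ∀ (Ω : Finset (HiggsLattice.Site P 0)), B1TorusRegionHSizes.IsBigBlockUnion K K₀ Ω →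
      ∀ (A : HiggsLattice.VecField P 0) {ec : ℝ}, 0 < ec → ec ≤ e₁ →
      (∀ z ∈ Ω, ∀ μ ν : Fin P.d,
          P.mesh K * |C.e| / ec * |A ⟨z.shift μ, ν⟩ - A ⟨z, ν⟩| ≤ creg * ec ^ (β - 1) / (P.L : ℝ) ^ K) →
      ∀ (x : HiggsLattice.Site P 0),
        (∀ y, HiggsLattice.Site.tdist x y
            ≤ 2 * B1TorusCubeLocality26.rS P K K₀ + 2 * B1TorusCubeCover.half P K K₀ * (P.d + 1) → y ∈ Ω) →
        ∀ {msq : ℝ}, 0 < msq → msq ≤ 1 →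
        ∀ (g : HiggsLattice.ScalarField P 0 N) (M D : ℝ), (∀ y, ‖g y‖ ≤ M) → 0 ≤ D →
          (∀ z, g z ≠ 0 → D ≤ (HiggsLattice.Site.tdist x z : ℝ)) →
            ‖propagatorK C Ω A msq a K (B1TorusRegionRop.chi Ω • g) x‖
              ≤ c₀ * P.mesh K ^ 2 * Real.exp (-(D / (4 * K₀ * (P.L : ℝ) ^ K))) * M := by
  obtain ⟨K₀min, hK⟩ :=
    B1Ineq225RegularRegion.norm_propagatorK_region_reg_decay_sum d L hd hL ha one_pos N C ε₀ creg β hcreg hβ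
  refine ⟨K₀min, fun K₀ hK₀ => ?_⟩
  obtain ⟨c₀, e₁, hc₀, he₁, hB1⟩ := hK K₀ hK₀
  refine ⟨c₀, e₁, hc₀, he₁, ?_⟩
  intro P hPd hPL hM K hK1 hKK hsize hmesh Ω hbig A ec hec hece hreg x hint msq hmsq hmsq1 g M D hgM hD hsupp
  obtain ⟨t, ht, ht1, rfl⟩ : ∃ t : ℝ, 0 < t ∧ t ≤ 1 ∧ t ^ 2 = msq :=
    ⟨Real.sqrt msq, Real.sqrt_pos.2 hmsq, by rw [← Real.sqrt_one]; exact Real.sqrt_le_sqrt hmsq1, Real.sq_sqrt hmsq.le⟩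
  subst hPL
  have hak : 0 ≤ B1.aSeq a (P.L : ℝ) K :=
    (B1.aSeq_pos ha (by exact_mod_cast (show 1 < P.L by omega)) hK1).le
  -- (2.25) at `m² = 1` on the `tε`-torus
  have hb := hB1 (P.scaleBy t ht) hPd rfl hM hK1 hKK (fun μ => hsize μ)
    (by
      rw [mesh_scaleBy]
      exact (mul_le_of_le_one_left (P.mesh_pos K).le ht1).trans hmesh)
    Ω (fun y y' h => hbig y y' h) (fun b => t⁻¹ * A ⟨b.src, b.dir⟩) hec hece
    (fun z hz μ ν => by
      rw [mesh_scaleBy]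
      show t * P.mesh K * |C.e| / ec * |t⁻¹ * A ⟨HiggsLattice.Site.shift (P := P) z μ, ν⟩ - t⁻¹ * A ⟨z, ν⟩|
          ≤ creg * ec ^ (β - 1) / (P.L : ℝ) ^ K
      have key : ∀ X : ℝ, t * P.mesh K * |C.e| / ec * (t⁻¹ * X) = P.mesh K * |C.e| / ec * X := fun X => by field_simp
      rw [← mul_sub, abs_mul, abs_of_pos (inv_pos.2 ht), key]
      exact hreg z hz μ ν)
    x (fun y hy => hint y hy) g M D hgM hD hsupp
  -- the scaling identity, pointwise at `x`
  have hsc := congrFun (propagatorK_scaleBy_div (Q := P) ht C Ω A a K hak (B1TorusRegionRop.chi Ω • g)) x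
  have hval : propagatorK C Ω A (t ^ 2) a K (B1TorusRegionRop.chi Ω • g) x
      = t⁻¹ ^ 2 • propagatorK (P := P.scaleBy t ht) C Ω (fun b => t⁻¹ * A ⟨b.src, b.dir⟩) 1 a K
          (B1TorusRegionRop.chi Ω • g) x := by
    rw [hsc]
    show _ = t⁻¹ ^ 2 • (t ^ 2 • propagatorK C Ω A (t ^ 2) a K (B1TorusRegionRop.chi Ω • g) x)
    rw [smul_smul, show t⁻¹ ^ 2 * t ^ 2 = 1 by field_simp, one_smul]
  have hb' : ‖propagatorK (P := P.scaleBy t ht) C Ω (fun b => t⁻¹ * A ⟨b.src, b.dir⟩) 1 a K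
      (B1TorusRegionRop.chi Ω • g) x‖
        ≤ c₀ * (P.scaleBy t ht).mesh K ^ 2 * Real.exp (-(D / (4 * K₀ * ((P.scaleBy t ht).L : ℝ) ^ K))) * M := hb
  rw [mesh_scaleBy, show ((P.scaleBy t ht).L : ℝ) = P.L from rfl] at hb'
  rw [hval, norm_smul, Real.norm_of_nonneg (pow_nonneg (inv_pos.2 ht).le 2)]
  calc t⁻¹ ^ 2 * _ ≤ t⁻¹ ^ 2 * (c₀ * (t * P.mesh K) ^ 2 * Real.exp (-(D / (4 * K₀ * (P.L : ℝ) ^ K))) * M) :=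
        mul_le_mul_of_nonneg_left hb' (pow_nonneg (inv_pos.2 ht).le 2)
    _ = _ := by field_simp

end UniformMass

end

end Literature.MathematicalPhysics.QuantumFieldTheory.BalabanImbrieJaffe1984to88.BIJ85NeumannPropagatorRegularDecay
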